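import Summits.HubbardSuperconductivity.HubbardSuperconductivity.Theorems.AnisotropyChordTransferFibre3FinGreenRC
import Summits.HubbardSuperconductivity.HubbardSuperconductivity.Theorems.AnisotropyChordTransferFibre3FinMHoleConv

/-!
# Route `AnisotropyChord` / H0 rotor rung: FIN layers 1c/2d/3d — the regime certificate on ROW–COLUMN tables

The profile table `fTab4` and the `ex`-gradient table `gTab4` of the explicit ground profile on a λ-cell built from the
row–column Green tables of `…Fibre3FinGreenRC` (`gresRCTab`, `gdiffRCTab`; `O(L³)` per table), the one-direction oracle
`cellOracle4`, the certificate `mholeCellOK4` / `mholeCheck4` (convolution form `SIv3`/`NIv3` of `…Fibre3FinConvCell` on the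
new tables) and ★ `mHole_nonneg_of_cells4` (`7 ≤ L`, `mholeCheck4 L cells = true`, `0 < Δ < 1` ⇒ `0 ≤ mHole L Δ f` for
every ground profile).  Soundness: `tabEncl_fTab4`, `mem_dIv4`, `mem_cellOracle4`; the rest is the chain of `mHole_nonneg_of_cells3`.
Prover seat `hubbard-h0-rotor-p3` g4; helper for stmt-HubbardSuperconductivity-23918 (piece A of rung 19089; `--supports`, helper class).
WHAT THIS IS NOT: nothing here proves superconductivity in the Hubbard model; soundness of a FIN certificate for the regime
clause of one conditional reduction. Tree imports only; no sorry.
-/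

set_option linter.dupNamespace false
set_option autoImplicit false

noncomputable section

namespace Summit.HubbardSuperconductivity.HubbardSuperconductivity.Theorems.AnisotropyChord.Transfer.Fibre3

namespace FinCell

open scoped BigOperators
open Finset Hole2

variable (L : ℕ) [NeZero L]

/-! ## Layers 1c/2d/3d: definitions (computable, zero data) -/

/-- the ground profile at `(r₁,r₂) ≠ 0` from a Green table `gt`: `Δf_nn + c_s·(G₀ − G̃(r))`. [folklore] -/
def groundFIvT (L : ℕ) (la lb : ℤ) (gt : List (List Iv)) (r1 r2 : ℕ) : Iv :=
  iadd (dfnnIv L la lb) (imul (csIv L la lb) (isub (G0Iv L la lb) (getF gt r1 r2)))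

/-- the profile table from a Green table (`0` at the origin). [folklore] -/
def fTabT (L : ℕ) (la lb : ℤ) (gt : List (List Iv)) : List (List Iv) :=
  mkTab L fun r1 r2 => if r1 = 0 ∧ r2 = 0 then (0, 0) else groundFIvT L la lb gt r1 r2

/-- ★ the profile table on row–column Green tables. [folklore] -/
def fTab4 (L : ℕ) (la lb : ℤ) : List (List Iv) := fTabT L la lb (gresRCTab L la lb)

/-- `D_{ex} f(r)`: table difference at the origin cases, `−c_s·(G̃(r) − G̃(r − ex))` from the difference table `gd` otherwise. [folklore] -/
def dIv4 (L : ℕ) (la lb : ℤ) (ft gd : List (List Iv)) (r1 r2 : ℕ) : Iv :=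
  if (r1 = 0 ∧ r2 = 0) ∨ (subm L r1 1 = 0 ∧ subm L r2 0 = 0) then
    isub (getF ft r1 r2) (getF ft (subm L r1 1) (subm L r2 0))
  else ineg (imul (csIv L la lb) (getF gd r1 r2))

/-- the `ex`-gradient table from a profile table and a difference table. [folklore] -/
def gTabT (L : ℕ) (la lb : ℤ) (ft gd : List (List Iv)) : List (List Iv) :=
  mkTab L fun r1 r2 => dIv4 L la lb ft gd r1 r2

/-- ★ the `ex`-gradient table on row–column tables. [folklore] -/
def gTab4 (L : ℕ) (la lb : ℤ) : List (List Iv) := gTabT L la lb (fTab4 L la lb) (gdiffRCTab L la lb)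

/-- the one-direction oracle: the `ex` table, the layer-2b evaluator otherwise (never reached by `SIv3`). [folklore] -/
def dOracle4 (L : ℕ) (la lb : ℤ) (t10 : List (List Iv)) (e1 e2 r1 r2 : ℕ) : Iv :=
  if e1 = 1 ∧ e2 = 0 then getF t10 r1 r2 else dIv2 L la lb (fTab L la lb) e1 e2 r1 r2

/-- ★ the cell oracle on row–column tables. [folklore] -/
def cellOracle4 (L : ℕ) (la lb : ℤ) : ℕ → ℕ → ℕ → ℕ → Iv := dOracle4 L la lb (gTab4 L la lb)

/-- `T⁺ = 3λ + S/N`, convolution form on row–column tables. [folklore] -/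
def tplusIv4 (L : ℕ) (la lb : ℤ) : Iv :=
  iadd (iscale 3 (la, lb)) (imul (SIv3 L (fTab4 L la lb) (cellOracle4 L la lb)) (iinv (NIv3 L (fTab4 L la lb))))

/-- one cell of the regime certificate on row–column tables. [folklore] -/
def mholeCellOK4 (L : ℕ) (la lb : ℤ) : Bool :=
  groundCellCheck L la lb &&
    (decide ((deltaIv L la lb).2 < 0) ||
      (decide (0 < (NIv3 L (fTab4 L la lb)).1) && decide ((tplusIv4 L la lb).2 ≤ (boundIv L).1)))

/-- ★ the per-`L` certificate on row–column tables. [folklore] -/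
def mholeCheck4 (L : ℕ) (cells : List ℤ) : Bool :=
  decide (cells.head? = some 0) && decide (2 ≤ cells.length) && decide (lamTop L ≤ cellsLast cells)
    && cellsAll (mholeCellOK4 L) cells

/-! ## Soundness of the tables -/

variable {L}

/-- ★ the profile table encloses the explicit ground profile. [folklore] -/
theorem tabEncl_fTab4 (hL : 3 ≤ L) {lam : ℝ} (hlam : 0 < lam) {la lb : ℤ}
    (hla : (la : ℝ) ≤ lam * ((D : ℤ) : ℝ)) (hlb : lam * ((D : ℤ) : ℝ) ≤ (lb : ℝ))
    (hchk : groundCellCheck L la lb = true) :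
    TabEncl L (groundF L lam) (fTab4 L la lb) := by
  intro r1 r2 h1 h2
  obtain ⟨hpos, _, _⟩ := groundCellCheck_spec hchk
  unfold fTab4 fTabT
  rw [getF_mkTab _ h1 h2]
  by_cases hr : r1 = 0 ∧ r2 = 0
  · rw [if_pos hr]
    obtain ⟨e1, e2⟩ := hr
    subst e1; subst e2
    have e : ((((0 : ℕ) : ZMod L), (((0 : ℕ) : ZMod L))) : Tor L) = 0 := by ext <;> simp
    rw [e]
    unfold groundF
    rw [if_pos rfl]
    have := mem_exact 0
    push_cast at this
    rw [zero_div] at this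
    exact this
  · rw [if_neg hr]
    have hne : ((((r1 : ℕ) : ZMod L), (((r2 : ℕ) : ZMod L))) : Tor L) ≠ 0 := by
      rw [Ne, Prod.mk_eq_zero, natCast_zmod_eq_zero L h1, natCast_zmod_eq_zero L h2]
      exact hr
    unfold groundF
    rw [if_neg hne]
    unfold groundFIvT aKer
    exact mem_iadd (mem_deltaMulFnn_cell L hL hlam hla hlb hchk)
      (mem_imul (mem_groundCs_cell L hL hlam hla hlb hchk)
        (mem_isub (mem_G0_cell L hL hla hlb hpos) (mem_gresRC_cell hL hla hlb hpos h1 h2)))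

/-- ★ the gradient entry encloses `D_{ex}(groundF L λ)(r₁,r₂)`. [folklore] -/
theorem mem_dIv4 (hL : 3 ≤ L) {lam : ℝ} (hlam : 0 < lam) {la lb : ℤ}
    (hla : (la : ℝ) ≤ lam * ((D : ℤ) : ℝ)) (hlb : lam * ((D : ℤ) : ℝ) ≤ (lb : ℝ))
    (hchk : groundCellCheck L la lb = true) {r1 r2 : ℕ} (hr1 : r1 < L) (hr2 : r2 < L) :
    mem (Dgrad L (groundF L lam) ((((1 : ℕ) : ZMod L)), (((0 : ℕ) : ZMod L)))
          ((((r1 : ℕ) : ZMod L)), (((r2 : ℕ) : ZMod L))))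
      (dIv4 L la lb (fTab4 L la lb) (gdiffRCTab L la lb) r1 r2) := by
  have hL0 : 0 < L := by omega
  have h1L : 1 < L := by omega
  have hft := tabEncl_fTab4 hL hlam hla hlb hchk
  obtain ⟨hpos, _, _⟩ := groundCellCheck_spec hchk
  unfold dIv4
  by_cases hc : (r1 = 0 ∧ r2 = 0) ∨ (subm L r1 1 = 0 ∧ subm L r2 0 = 0)
  · rw [if_pos hc]
    exact mem_dIv hft h1L hL0 hr1 hr2
  · rw [if_neg hc]
    push Not at hc
    obtain ⟨hc1, hc2⟩ := hc
    have hs1 := subm_lt L r1 1 hL0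
    have hs2 := subm_lt L r2 0 hL0
    have hr : ((((r1 : ℕ) : ZMod L), (((r2 : ℕ) : ZMod L))) : Tor L) ≠ 0 := by
      rw [Ne, Prod.mk_eq_zero, natCast_zmod_eq_zero L hr1, natCast_zmod_eq_zero L hr2]
      exact fun h => hc1 h.1 h.2
    have hs : ((((subm L r1 1 : ℕ) : ZMod L), (((subm L r2 0 : ℕ) : ZMod L))) : Tor L) ≠ 0 := by
      rw [Ne, Prod.mk_eq_zero, natCast_zmod_eq_zero L hs1, natCast_zmod_eq_zero L hs2]
      exact fun h => hc2 h.1 h.2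
    unfold Dgrad
    rw [pt_sub 1 0 r1 r2 h1L hL0, groundF_sub lam hr hs]
    have hsub0 : subm L r2 0 = r2 := by
      unfold subm; rw [Nat.sub_zero, Nat.add_mod_right, Nat.mod_eq_of_lt hr2]
    have hsub1 : subm L r1 1 = (r1 + L - 1) % L := rfl
    rw [hsub0, hsub1]
    exact mem_ineg (mem_imul (mem_groundCs_cell L hL hlam hla hlb hchk) (mem_gdiffRC_cell hL hla hlb hpos hr1 hr2))

/-- ★ the row–column cell oracle encloses `D_e (groundF L λ)` for every direction given by natural coordinates `< L`. [folklore] -/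
theorem mem_cellOracle4 (hL : 3 ≤ L) {lam : ℝ} (hlam : 0 < lam) {la lb : ℤ}
    (hla : (la : ℝ) ≤ lam * ((D : ℤ) : ℝ)) (hlb : lam * ((D : ℤ) : ℝ) ≤ (lb : ℝ))
    (hchk : groundCellCheck L la lb = true) :
    ∀ e1 e2 r1 r2 : ℕ, e1 < L → e2 < L → r1 < L → r2 < L →
      mem (Dgrad L (groundF L lam) ((((e1 : ℕ) : ZMod L)), (((e2 : ℕ) : ZMod L)))
          ((((r1 : ℕ) : ZMod L)), (((r2 : ℕ) : ZMod L))))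
        (cellOracle4 L la lb e1 e2 r1 r2) := by
  intro e1 e2 r1 r2 he1 he2 hr1 hr2
  unfold cellOracle4 dOracle4
  split_ifs with h1
  · obtain ⟨rfl, rfl⟩ := h1
    unfold gTab4 gTabT
    rw [getF_mkTab _ hr1 hr2]
    exact mem_dIv4 hL hlam hla hlb hchk hr1 hr2
  · exact mem_dIv2 hL hlam hla hlb hchk he1 he2 hr1 hr2

/-! ## Soundness of the certificate -/

variable (L)

/-- ★★ SOUNDNESS ON ROW–COLUMN TABLES: `mholeCheck4 L cells = true` ⇒ `0 ≤ mHole L Δ f` for every ground profile, every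
`0 < Δ < 1` (`7 ≤ L`). [folklore] -/
theorem mHole_nonneg_of_cells4 (hL : 7 ≤ L) (cells : List ℤ) (hchk : mholeCheck4 L cells = true)
    {Δ : ℝ} (hΔ0 : 0 < Δ) (hΔ1 : Δ < 1) :
    ∀ lam2 : ℝ, ∀ f : Tor L → ℝ, IsGroundTwoMagnon L Δ lam2 f → 0 ≤ mHole L Δ f := by
  refine forall_ground_of_window_7 L hL hΔ0.le hΔ1 (fun _ f => 0 ≤ mHole L Δ f) ?_
  intro lam2 f hf hlam0 hlamle
  have hD := D_pos
  unfold mholeCheck4 at hchk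
  simp only [Bool.and_eq_true, decide_eq_true_eq] at hchk
  obtain ⟨⟨⟨hhead, hlen⟩, htop⟩, hok⟩ := hchk
  obtain ⟨a, b, rest, hcells⟩ : ∃ a b : ℤ, ∃ rest : List ℤ, cells = a :: b :: rest := by
    match cells, hlen with
    | a :: b :: rest, _ => exact ⟨a, b, rest, rfl⟩
  subst hcells
  have ha0 : a = 0 := by simpa using hhead
  subst ha0
  set x : ℝ := lam2 * ((D : ℤ) : ℝ) with hx
  have hx0 : ((0 : ℤ) : ℝ) ≤ x := by rw [hx]; push_cast; positivity
  have hxtop : x ≤ ((cellsLast ((0 : ℤ) :: b :: rest) : ℤ) : ℝ) :=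
    (lam_mul_D_le_lamTop L (by omega) hlamle).trans (by exact_mod_cast htop)
  obtain ⟨c, d, hcell, hcx, hxd⟩ := cover_all (mholeCellOK4 L) rest 0 b x hok hx0 hxtop
  have hfe : f = groundF L lam2 := ground_eq_explicit L (by omega) hΔ0.le hΔ1 hf
  have hΔe : Δ = deltaOfLam L lam2 := ground_delta_eq L (by omega) hΔ0.le hΔ1 hf
  have hf2 : IsTwoMagnon L Δ lam2 f := hf.1
  have hev : ∀ r : Tor L, f (-r) = f r := hf.2.1
  have hsw : ∀ r : Tor L, f (r.2, r.1) = f r := by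
    intro r; rw [hfe]; exact groundF_swap lam2 r
  unfold mholeCellOK4 at hcell
  simp only [Bool.and_eq_true, Bool.or_eq_true, decide_eq_true_eq] at hcell
  obtain ⟨hgc, hcase⟩ := hcell
  rcases hcase with hvac | ⟨hN, hT⟩
  · exfalso
    have hmd := mem_delta_cell L (by omega) hlam0 hcx hxd hgc
    rw [← hΔe] at hmd
    obtain ⟨_, hhi⟩ := hmd
    have : ((((deltaIv L c d).2 : ℤ)) : ℝ) < 0 := by exact_mod_cast hvac
    nlinarith
  · have htab : TabEncl L f (fTab4 L c d) := by
      rw [hfe]; exact tabEncl_fTab4 (by omega) hlam0 hcx hxd hgc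
    have horc : ∀ e1 e2 r1 r2 : ℕ, e1 < L → e2 < L → r1 < L → r2 < L →
        mem (Dgrad L f ((((e1 : ℕ) : ZMod L)), (((e2 : ℕ) : ZMod L))) ((((r1 : ℕ) : ZMod L)), (((r2 : ℕ) : ZMod L))))
          (cellOracle4 L c d e1 e2 r1 r2) := by
      rw [hfe]; exact mem_cellOracle4 (by omega) hlam0 hcx hxd hgc
    have mN : mem (PiNormSq L f) (NIv3 L (fTab4 L c d)) := mem_NIv3 htab
    have mS : mem (∑ cc : Cfg L, piR L f cc * C0fn L Δ lam2 f cc) (SIv3 L (fTab4 L c d) (cellOracle4 L c d)) :=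
      mem_SIv3 (by omega) hf2 hev hsw htab horc
    have hNpos : 0 < PiNormSq L f := by
      obtain ⟨hlo, _⟩ := mN
      have : (0 : ℝ) < (((NIv3 L (fTab4 L c d)).1 : ℤ) : ℝ) := by exact_mod_cast hN
      nlinarith
    have hS := sum_piR_C0fn L hf2
    have hTeq : Tplus L Δ f = 3 * lam2 + (∑ cc : Cfg L, piR L f cc * C0fn L Δ lam2 f cc) * (1 / PiNormSq L f) := by
      rw [hS]; field_simp; ring
    have mT : mem (Tplus L Δ f) (tplusIv4 L c d) := by
      rw [hTeq]
      unfold tplusIv4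
      have h3 : mem (3 * lam2) (iscale 3 (c, d)) := by
        have := mem_iscale 3 (mem_lam hcx hxd); push_cast at this; exact this
      exact mem_iadd h3 (mem_imul mS (mem_iinv mN hN))
    have mB := mem_bound L (by omega)
    obtain ⟨_, hThi⟩ := mT
    obtain ⟨hBlo, _⟩ := mB
    have hle : ((((tplusIv4 L c d).2 : ℤ)) : ℝ) ≤ ((((boundIv L).1 : ℤ)) : ℝ) := by exact_mod_cast hT
    unfold mHole
    nlinarith

end FinCell

end Summit.HubbardSuperconductivity.HubbardSuperconductivity.Theorems.AnisotropyChord.Transfer.Fibre3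

end
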